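import Mathlib.Topology.Algebra.InfiniteSum.NatInt
import Mathlib.Topology.Algebra.InfiniteSum.Order
import Mathlib.Topology.Algebra.InfiniteSum.Real
import Mathlib.Analysis.SpecialFunctions.Pow.Real
import HarnessLib

/-!
# TRUNCATED SPECTRAL SUMS — tails of `Σ_k λ_k^p w_k a_k b_k` behind a cluster (pure real analysis; F9 groundwork for S-PSCAL″ of crux `DressedRitz`,
# stmt-QuantumFields-20205, line «polyakovlift» r6; LEAD prover g2)

With the exact spectral representation `⟨K^m v, K^n w⟩ = Σ_k λ_k^{m+n} a_k b_k` (tree `FemtoTransferGapSpectralSums`), the dressed one-site numbers of S-PSCAL″ are series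
with ANTITONE non-negative weights `λ_k`.  This file isolates the elementary tail estimates used by the assembly: split at an index `M`; beyond `M`,
`λ_k^p ≤ λ_M^p`, so an energy weight `(κ − λ_k) ≥ 0` turns a dressed tail into `λ_M^p ×` an UNDRESSED energy tail, and cross tails are handled by the weighted
AM–GM inequality (no infinite Cauchy–Schwarz needed).  Everything is phrased with `HasSum` values.

* `hasSum_tail` (value of the tail), `tail_nonpos`, `tail_le_of_le` (comparison), `energy_tail_le` (`Σ_{≥M} λ^p(κ−λ)a² ≤ λ_M^p Σ_{≥M}(κ−λ)a²`),
  `cross_tail_le` (`|Σ_{≥M} λ^p(κ−λ)ab| ≤ λ_M^p (t·E_a + E_b/t)/2`), `plain_cross_tail_le` (`|Σ_{≥M} λ^p ab| ≤ λ_M^p (t·N_a + N_b/t)/2`).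

HONEST FRAMING: real-analysis plumbing; nothing here bears on infinite volume, the continuum limit or the Clay gap.
References: Reed–Simon IV, Thm. XIII.1 [cite: ReedSimonIV1978, Thm. XIII.1].
-/

set_option autoImplicit false

noncomputable section

open Finset
open scoped BigOperators

namespace Summit.QuantumFields.YangMills.Theorems.FemtoTransferGap.SpecSum

/-! ## §1 Tails as `HasSum` values -/

/-- The tail beyond `M` of a convergent series has the value `S − Σ_{k<M} f k`. [folklore] -/
theorem hasSum_tail {f : ℕ → ℝ} {S : ℝ} (h : HasSum f S) (M : ℕ) :
    HasSum (fun k => f (k + M)) (S - ∑ k ∈ range M, f k) := by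
  rw [hasSum_nat_add_iff M, sub_add_cancel]
  exact h

/-- A tail of non-positive terms is non-positive. [folklore] -/
theorem tail_nonpos {f : ℕ → ℝ} {S : ℝ} (h : HasSum f S) (M : ℕ) (hf : ∀ k, M ≤ k → f k ≤ 0) :
    S - ∑ k ∈ range M, f k ≤ 0 :=
  hasSum_le (fun k => hf (k + M) (Nat.le_add_left M k)) (hasSum_tail h M) hasSum_zero

/-- A tail of non-negative terms is non-negative. [folklore] -/
theorem tail_nonneg {f : ℕ → ℝ} {S : ℝ} (h : HasSum f S) (M : ℕ) (hf : ∀ k, M ≤ k → 0 ≤ f k) :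
    0 ≤ S - ∑ k ∈ range M, f k :=
  hasSum_le (fun k => hf (k + M) (Nat.le_add_left M k)) hasSum_zero (hasSum_tail h M)

/-- Termwise comparison of tails. [folklore] -/
theorem tail_le_of_le {f g : ℕ → ℝ} {S T : ℝ} (hf : HasSum f S) (hg : HasSum g T) (M : ℕ) (hle : ∀ k, M ≤ k → f k ≤ g k) :
    S - ∑ k ∈ range M, f k ≤ T - ∑ k ∈ range M, g k :=
  hasSum_le (fun k => hle (k + M) (Nat.le_add_left M k)) (hasSum_tail hf M) (hasSum_tail hg M)

/-- Partial sums of a non-negative convergent series are below its value. [folklore] -/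
theorem sum_le_of_hasSum {f : ℕ → ℝ} {S : ℝ} (h : HasSum f S) (hf : ∀ k, 0 ≤ f k) (M : ℕ) : ∑ k ∈ range M, f k ≤ S := by
  have := tail_nonneg h M fun k _ => hf k
  linarith

/-! ## §2 Dressed tails behind a cluster: antitone non-negative weights -/

variable {lam a b : ℕ → ℝ}

/-- Beyond `M`, `λ_k^p ≤ λ_M^p` for an antitone non-negative `λ`. [folklore] -/
theorem pow_le_pow_of_antitone (hanti : Antitone lam) (hnn : ∀ k, 0 ≤ lam k) (p : ℕ) {M k : ℕ} (hk : M ≤ k) :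
    lam k ^ p ≤ lam M ^ p :=
  pow_le_pow_left₀ (hnn k) (hanti hk) p

/-- ★ **Energy tail**: if `λ_k ≤ κ` for `k ≥ M` then `Σ_{k≥M} λ_k^p (κ − λ_k) a_k² ≤ λ_M^p · Σ_{k≥M} (κ − λ_k) a_k²` (values of the two series `S_p`, `S_0`).
[cite: ReedSimonIV1978, Thm. XIII.1] -/
theorem energy_tail_le (hanti : Antitone lam) (hnn : ∀ k, 0 ≤ lam k) (p M : ℕ) {κ : ℝ} (hκ : lam M ≤ κ) {Sp S0 : ℝ}
    (hSp : HasSum (fun k => lam k ^ p * ((κ - lam k) * a k ^ 2)) Sp) (hS0 : HasSum (fun k => (κ - lam k) * a k ^ 2) S0) :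
    Sp - ∑ k ∈ range M, lam k ^ p * ((κ - lam k) * a k ^ 2) ≤ lam M ^ p * (S0 - ∑ k ∈ range M, (κ - lam k) * a k ^ 2) := by
  have h := tail_le_of_le hSp (hS0.mul_left (lam M ^ p)) M fun k hk => by
    have hw : 0 ≤ (κ - lam k) * a k ^ 2 := mul_nonneg (by linarith [hanti hk]) (sq_nonneg _)
    exact mul_le_mul_of_nonneg_right (pow_le_pow_of_antitone hanti hnn p hk) hw
  rw [mul_sub, Finset.mul_sum]
  exact h

/-- Weighted AM–GM: `|x y| ≤ (t x² + y²/t)/2` for `t > 0`. [folklore] -/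
theorem abs_mul_le_amgm {t : ℝ} (ht : 0 < t) (x y : ℝ) : |x * y| ≤ (t * x ^ 2 + y ^ 2 / t) / 2 := by
  rw [abs_mul]
  have h := sq_nonneg (t * |x| - |y|)
  have hx := sq_abs x
  have hy := sq_abs y
  have key : 2 * t * (|x| * |y|) ≤ t * (t * x ^ 2) + y ^ 2 := by
    have e : (t * |x| - |y|) ^ 2 = t * (t * |x| ^ 2) + |y| ^ 2 - 2 * t * (|x| * |y|) := by ring
    rw [hx, hy] at e
    linarith [h, e]
  calc |x| * |y| = 2 * t * (|x| * |y|) / (2 * t) := by field_simp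
    _ ≤ (t * (t * x ^ 2) + y ^ 2) / (2 * t) := by gcongr
    _ = (t * x ^ 2 + y ^ 2 / t) / 2 := by field_simp

/-- ★ **Cross energy tail** (weighted AM–GM, any `t > 0`): if `λ_k ≤ κ` for `k ≥ M` then
`|Σ_{k≥M} λ_k^p (κ − λ_k) a_k b_k| ≤ λ_M^p · (t·E_a + E_b/t)/2`, `E_a = Σ_{k≥M}(κ − λ_k)a_k²`, `E_b` likewise. [folklore] -/
theorem cross_tail_le (hanti : Antitone lam) (hnn : ∀ k, 0 ≤ lam k) (p M : ℕ) {κ : ℝ} (hκ : lam M ≤ κ) {t : ℝ} (ht : 0 < t)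
    {Sab Sa Sb : ℝ} (hSab : HasSum (fun k => lam k ^ p * ((κ - lam k) * (a k * b k))) Sab)
    (hSa : HasSum (fun k => (κ - lam k) * a k ^ 2) Sa) (hSb : HasSum (fun k => (κ - lam k) * b k ^ 2) Sb) :
    |Sab - ∑ k ∈ range M, lam k ^ p * ((κ - lam k) * (a k * b k))| ≤
      lam M ^ p * ((t * (Sa - ∑ k ∈ range M, (κ - lam k) * a k ^ 2) + (Sb - ∑ k ∈ range M, (κ - lam k) * b k ^ 2) / t) / 2) := by
  -- the dominating series `g_k = λ_M^p (κ − λ_k)(t a² + b²/t)/2`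
  set g : ℕ → ℝ := fun k => lam M ^ p * ((κ - lam k) * ((t * a k ^ 2 + b k ^ 2 / t) / 2)) with hg
  have hG : HasSum g (lam M ^ p * ((t * Sa + Sb / t) / 2)) := by
    have h1 : HasSum (fun k => (κ - lam k) * ((t * a k ^ 2 + b k ^ 2 / t) / 2)) ((t * Sa + Sb / t) / 2) := by
      have := ((hSa.mul_left t).add (hSb.div_const t)).div_const 2
      refine this.congr_fun fun k => ?_
      ring
    exact h1.mul_left _
  have hbound : ∀ k, M ≤ k → |lam k ^ p * ((κ - lam k) * (a k * b k))| ≤ g k := by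
    intro k hk
    have hw : 0 ≤ κ - lam k := by linarith [hanti hk]
    have hlp : 0 ≤ lam k ^ p := pow_nonneg (hnn k) p
    rw [abs_mul, abs_mul, abs_of_nonneg hlp, abs_of_nonneg hw]
    calc lam k ^ p * ((κ - lam k) * |a k * b k|) ≤ lam M ^ p * ((κ - lam k) * ((t * a k ^ 2 + b k ^ 2 / t) / 2)) :=
          mul_le_mul (pow_le_pow_of_antitone hanti hnn p hk) (mul_le_mul_of_nonneg_left (abs_mul_le_amgm ht _ _) hw)
            (mul_nonneg hw (abs_nonneg _)) (pow_nonneg (hnn M) p)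
      _ = g k := rfl
  have hup := tail_le_of_le hSab hG M fun k hk => (le_abs_self _).trans (hbound k hk)
  have hlo := tail_le_of_le (hG.neg) hSab M fun k hk => by
    have := (neg_abs_le _).trans' (neg_le_neg (hbound k hk)); simpa using this
  have eG : (lam M ^ p * ((t * Sa + Sb / t) / 2)) - ∑ k ∈ range M, g k =
      lam M ^ p * ((t * (Sa - ∑ k ∈ range M, (κ - lam k) * a k ^ 2) + (Sb - ∑ k ∈ range M, (κ - lam k) * b k ^ 2) / t) / 2) := by
    have hsplit : ∀ k, g k = (lam M ^ p * t / 2) * ((κ - lam k) * a k ^ 2) + (lam M ^ p / (2 * t)) * ((κ - lam k) * b k ^ 2) := fun k => by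
      simp only [hg]; ring
    have hsum : ∑ k ∈ range M, g k =
        (lam M ^ p * t / 2) * ∑ k ∈ range M, (κ - lam k) * a k ^ 2 + (lam M ^ p / (2 * t)) * ∑ k ∈ range M, (κ - lam k) * b k ^ 2 := by
      simp_rw [hsplit, Finset.sum_add_distrib, ← Finset.mul_sum]
    rw [hsum]; field_simp; ring
  rw [abs_le]
  constructor
  · have : -(lam M ^ p * ((t * Sa + Sb / t) / 2)) - ∑ k ∈ range M, -g k ≤ Sab - ∑ k ∈ range M, lam k ^ p * ((κ - lam k) * (a k * b k)) := by
      simpa using hlo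
    rw [sum_neg_distrib] at this
    linarith [eG]
  · linarith [eG]

/-- ★ **Plain cross tail** (any `t > 0`): `|Σ_{k≥M} λ_k^p a_k b_k| ≤ λ_M^p · (t·Σ_{k≥M} a_k² + Σ_{k≥M} b_k²/t)/2`. [folklore] -/
theorem plain_cross_tail_le (hanti : Antitone lam) (hnn : ∀ k, 0 ≤ lam k) (p M : ℕ) {t : ℝ} (ht : 0 < t)
    {Sab Na Nb : ℝ} (hSab : HasSum (fun k => lam k ^ p * (a k * b k)) Sab)
    (hNa : HasSum (fun k => a k ^ 2) Na) (hNb : HasSum (fun k => b k ^ 2) Nb) :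
    |Sab - ∑ k ∈ range M, lam k ^ p * (a k * b k)| ≤
      lam M ^ p * ((t * (Na - ∑ k ∈ range M, a k ^ 2) + (Nb - ∑ k ∈ range M, b k ^ 2) / t) / 2) := by
  -- use `cross_tail_le` with `κ := lam M + 1` after rescaling?  Direct proof instead (same domination argument).
  set g : ℕ → ℝ := fun k => lam M ^ p * ((t * a k ^ 2 + b k ^ 2 / t) / 2) with hg
  have hG : HasSum g (lam M ^ p * ((t * Na + Nb / t) / 2)) := (((hNa.mul_left t).add (hNb.div_const t)).div_const 2).mul_left _
  have hbound : ∀ k, M ≤ k → |lam k ^ p * (a k * b k)| ≤ g k := by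
    intro k hk
    have hlp : 0 ≤ lam k ^ p := pow_nonneg (hnn k) p
    rw [abs_mul, abs_of_nonneg hlp]
    exact mul_le_mul (pow_le_pow_of_antitone hanti hnn p hk) (abs_mul_le_amgm ht _ _) (abs_nonneg _) (pow_nonneg (hnn M) p)
  have hup := tail_le_of_le hSab hG M fun k hk => (le_abs_self _).trans (hbound k hk)
  have hlo := tail_le_of_le (hG.neg) hSab M fun k hk => by
    have := (neg_abs_le _).trans' (neg_le_neg (hbound k hk)); simpa using this
  have eG : (lam M ^ p * ((t * Na + Nb / t) / 2)) - ∑ k ∈ range M, g k =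
      lam M ^ p * ((t * (Na - ∑ k ∈ range M, a k ^ 2) + (Nb - ∑ k ∈ range M, b k ^ 2) / t) / 2) := by
    have hsplit : ∀ k, g k = (lam M ^ p * t / 2) * a k ^ 2 + (lam M ^ p / (2 * t)) * b k ^ 2 := fun k => by
      simp only [hg]; ring
    have hsum : ∑ k ∈ range M, g k = (lam M ^ p * t / 2) * ∑ k ∈ range M, a k ^ 2 + (lam M ^ p / (2 * t)) * ∑ k ∈ range M, b k ^ 2 := by
      simp_rw [hsplit, Finset.sum_add_distrib, ← Finset.mul_sum]
    rw [hsum]; field_simp; ring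
  rw [abs_le]
  constructor
  · have : -(lam M ^ p * ((t * Na + Nb / t) / 2)) - ∑ k ∈ range M, -g k ≤ Sab - ∑ k ∈ range M, lam k ^ p * (a k * b k) := by
      simpa using hlo
    rw [sum_neg_distrib] at this
    linarith [eG]
  · linarith [eG]

end Summit.QuantumFields.YangMills.Theorems.FemtoTransferGap.SpecSum

end
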